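import Summits.NavierStokesRegularity.NavierStokesRegularity.Theses.FilamentSkeletonRss

/-!
# `CoreGluing` (stmt-NavierStokesRegularity-15401): axis-parallel cages are never supercritical

Negative-side support for crux `CoreGluing := SkeletonEquilibrium → RssProfileExists` of route
`FilamentSkeletonRss` (cdisprove seat, cycle 1, 2026-08-16); companion of
`…Theorems.CoreGluing.Negative.ThresholdLoadBearing`, which shows that the supercritical-stretching
clause `3/2 + δ ≤ w′(τ*)` is the ONLY load-bearing clause of the crux's hypothesis (the bare rotation
axis inhabits everything else, with `w′ ≡ 1/2`).  This file shows that the drift value `1/2` is not an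
artefact of the one-filament witness: for EVERY configuration of straight filaments parallel to the
rotation axis — any number `N`, positions `p_j`, circulation ratios `γ_j`, angular speed `α`,
circulation `Γ` — that satisfies the relative-equilibrium identity of `SkeletonEquilibrium` with
tangential speeds `w_j`, one has `w_j(τ) = ½(⟪p_j, e₃⟫ + τ)` (`parallel_lines_drift`: the regularised
Biot–Savart induction of parallel lines and the frame rotation `α e₃ × Ξ` are horizontal; only the
Leray drift `½Ξ` has an axial component), hence `w_j′ ≡ 1/2` and the supercritical clause fails for
every `δ > −1` (`parallel_lines_not_supercritical`).  Information for provers of both cruxes: the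
supercritical stretching `w′(τ*) > 3/2` that `CoreGluing` must consume (Burgers core area
`A = 4/(w′ − 3/2) > 0`) can only be produced by SKEW mutual induction, as in the 2001 certified `C₃`
skew triple and two-ring cage (whose axis filament is stretched by the rings).
-/

set_option linter.dupNamespace false

namespace Summit.NavierStokesRegularity.NavierStokesRegularity.Theorems.CoreGluing.Negative

open Summit.NavierStokesRegularity.NavierStokesRegularity.Theses.FilamentSkeletonRss
open Literature.Analysis.FluidPDE MeasureTheory
open scoped RealInnerProductSpace InnerProductSpace

/-- **Axis-parallel filaments drift at exactly the Leray rate.**  If every filament of a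
configuration is a straight line parallel to the rotation axis, `Ξ_j(τ) = p_j + τ e₃` (any number
`N`, any positions `p_j`, any circulation ratios, any `α`, `Γ`), and the relative-equilibrium identity
of `SkeletonEquilibrium` holds with tangential speeds `w_j`, then `w_j(τ) = ½(⟪p_j, e₃⟫ + τ)`:
the regularised Biot–Savart induction of parallel lines and the frame rotation are horizontal, so only
the Leray drift `½Ξ` has an axial component.  (The `e₃`-component of the identity; the Bochner
integral of a horizontal field is horizontal whether or not it converges.) [folklore] -/
theorem parallel_lines_drift {N : ℕ} (γ : Fin N → ℝ) (α Γ : ℝ)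
    (p : Fin N → EuclideanSpace ℝ (Fin 3)) (Ξ : Fin N → ℝ → EuclideanSpace ℝ (Fin 3))
    (hΞ : ∀ j, Ξ j = fun τ => p j + τ • EuclideanSpace.single (2 : Fin 3) (1 : ℝ))
    (w : Fin N → ℝ → ℝ)
    (heq : ∀ j τ, (∑ k : Fin N, (Γ * γ k / (4 * Real.pi)) • ∫ σ : ℝ, ((‖Ξ j τ - Ξ k σ‖ ^ 2 + 1) ^ (3 / 2 : ℝ))⁻¹ • Literature.Analysis.FluidPDE.cross (deriv (Ξ k) σ) (Ξ j τ - Ξ k σ)) + (1 / 2 : ℝ) • Ξ j τ - α • Literature.Analysis.FluidPDE.cross (EuclideanSpace.single (2 : Fin 3) (1 : ℝ)) (Ξ j τ) = w j τ • deriv (Ξ j) τ)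
    (j : Fin N) (τ : ℝ) :
    w j τ = (1 / 2) * (⟪p j, EuclideanSpace.single (2 : Fin 3) (1 : ℝ)⟫_ℝ + τ) := by
  set e₃ : EuclideanSpace ℝ (Fin 3) := EuclideanSpace.single (2 : Fin 3) (1 : ℝ) with he₃
  -- axial components: `⟪e₃ × v, e₃⟫ = 0`, `⟪e₃, e₃⟫ = 1`
  have hperp : ∀ v : EuclideanSpace ℝ (Fin 3), ⟪cross e₃ v, e₃⟫_ℝ = 0 := by
    intro v
    simp [he₃, cross, cross_apply, EuclideanSpace.inner_single_right]
  have hperp' : ∀ v : EuclideanSpace ℝ (Fin 3), ⟪e₃, cross e₃ v⟫_ℝ = 0 := fun v => by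
    rw [real_inner_comm]; exact hperp v
  have hunit : ⟪e₃, e₃⟫_ℝ = 1 := by
    simp [he₃]
  have hderiv : ∀ k σ, deriv (Ξ k) σ = e₃ := by
    intro k σ
    rw [hΞ k]
    rw [deriv_const_add, deriv_smul_const differentiableAt_id, deriv_id'', one_smul]
  -- the Bochner integral of a horizontal field is horizontal (or zero)
  have hint : ∀ k, ⟪(∫ σ : ℝ, ((‖Ξ j τ - Ξ k σ‖ ^ 2 + 1) ^ (3 / 2 : ℝ))⁻¹ •
      cross e₃ (Ξ j τ - Ξ k σ)), e₃⟫_ℝ = 0 := by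
    intro k
    by_cases hI : Integrable (fun σ : ℝ => ((‖Ξ j τ - Ξ k σ‖ ^ 2 + 1) ^ (3 / 2 : ℝ))⁻¹ •
        cross e₃ (Ξ j τ - Ξ k σ))
    · rw [real_inner_comm, ← integral_inner hI]
      simp_rw [real_inner_smul_right, hperp', mul_zero, integral_zero]
    · rw [integral_undef hI, inner_zero_left]
  have key := congrArg (fun v => ⟪v, e₃⟫_ℝ) (heq j τ)
  simp only [hderiv] at key
  simp only [inner_sub_left, inner_add_left, sum_inner, real_inner_smul_left, hint, mul_zero,
    Finset.sum_const_zero, zero_add, hperp, sub_zero, hunit, mul_one] at key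
  rw [← key, hΞ j]
  simp only [inner_add_left, real_inner_smul_left, hunit, mul_one]

/-- Hence an axis-parallel cage never meets the supercritical clause of `SkeletonEquilibrium`:
`w_j′ ≡ 1/2 < 3/2 + δ` for every `δ > -1`, in particular for the crux's `δ > 0`.  Supercritical
stretching must come from SKEW mutual induction (as in the 2001 certified `C₃` skew triple and
two-ring cage, whose axis line is stretched by the rings). [folklore] -/
theorem parallel_lines_not_supercritical {N : ℕ} (γ : Fin N → ℝ) (α Γ δ : ℝ) (hδ : -1 < δ)
    (p : Fin N → EuclideanSpace ℝ (Fin 3)) (Ξ : Fin N → ℝ → EuclideanSpace ℝ (Fin 3))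
    (hΞ : ∀ j, Ξ j = fun τ => p j + τ • EuclideanSpace.single (2 : Fin 3) (1 : ℝ))
    (w : Fin N → ℝ → ℝ)
    (heq : ∀ j τ, (∑ k : Fin N, (Γ * γ k / (4 * Real.pi)) • ∫ σ : ℝ, ((‖Ξ j τ - Ξ k σ‖ ^ 2 + 1) ^ (3 / 2 : ℝ))⁻¹ • Literature.Analysis.FluidPDE.cross (deriv (Ξ k) σ) (Ξ j τ - Ξ k σ)) + (1 / 2 : ℝ) • Ξ j τ - α • Literature.Analysis.FluidPDE.cross (EuclideanSpace.single (2 : Fin 3) (1 : ℝ)) (Ξ j τ) = w j τ • deriv (Ξ j) τ)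
    (j : Fin N) (τs : ℝ) :
    ¬ (3 / 2 + δ ≤ deriv (w j) τs) := by
  have hw : w j = fun τ => (1 / 2) * (⟪p j, EuclideanSpace.single (2 : Fin 3) (1 : ℝ)⟫_ℝ + τ) :=
    funext fun τ => parallel_lines_drift γ α Γ p Ξ hΞ w heq j τ
  have hd : deriv (w j) τs = 1 / 2 := by
    rw [hw, deriv_const_mul _ (differentiableAt_const _ |>.add differentiableAt_id), deriv_const_add,
      deriv_id'', mul_one]
  rw [hd]
  linarith

end Summit.NavierStokesRegularity.NavierStokesRegularity.Theorems.CoreGluing.Negative
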